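import Summits.FinalStateConjecture.FinalStateConjecture.Theorems.PhotonSphereChannelsChannelsResolveTameDevelopmentsROuterRegionNonempty
import HarnessLib

/-!
# Crux `ChannelsResolveTameDevelopmentsR` (K2R-T2, stmt-FinalStateConjecture-17430), line `dark-future-exactness`,
# stub T′ `stub_tameEndgame`: the EMPTY-OUTER-REGION FIBRE — why T′ carries the guard `(outerRegion 𝒟).Nonempty`

Documentation of Reshape 1 of the line's skeleton (`Cruxes/ChannelsResolveTameDevelopmentsR/Lines/dark_future_exactness.lean`,
module docstring "Reshape 1", outer-region guard (A′/T′)), kernel-checked: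

* §1 `outerRegion_eq_empty_iff_forall_bddAbove` / `outerRegion_nonempty_iff_exists_completeRay` — the fibre
  `outerRegion 𝒟 = ∅` is EXACTLY the class of developments all of whose normalised null rays from `Σ` are future
  INCOMPLETE; equivalently T′'s guard `(outerRegion 𝒟).Nonempty` holds iff ONE future-complete normalised null ray
  from `Σ` exists (⇐ is the glue M0 `DarkFuture.exists_embed_mem_outerRegion_of_completeRay`, `…ROuterRegionNonempty.lean`:
  a data point `ι x ≪ γ t` is outer; ⇒ is the shape of `TameHull.outerRegion = J⁺(ι X) ∩ ⋃ I⁻(complete rays)`).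
* §2 `hypotheses_of_outerRegion_eq_empty` (registered sub-goal) — on that fibre the WHOLE hypothesis block of T′
  (`0 < r₀ ∧ (a) OuterHullExists ∧ (b) GeneratorHullExists ∧ (c) rigidity of silent outer hull elements ∧ (d) parameter
  constancy along horizon paths`) holds for EVERY class `(Λ, r₀)`, `r₀ > 0`, vacuously: (a), (c) are guarded by
  `IsFutureEscaping q ⊇ (q 0 ∈ outerRegion 𝒟)`, (b), (d) by `IsHorizonPath γ ⊇ (γ 0 ∈ closure (outerRegion 𝒟))`
  (stub-worker T of wave 1, `work/stubs/stub_tameEndgame_reduction.lean`; cf. the landed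
  `DarkFuture.forall_not_isFutureEscaping_iff_outerRegion_eq_empty`, `…RTameEndgame.lean`, p150272). Hence WITHOUT the
  guard T would have owed the K2R♭ target from `DevHyp` alone on this fibre (it would contain Φ♭ there), while
  `DevHyp.scri` (sojourn form of complete `𝓘⁺`) asserts no complete ray; with the guard, supplied by the producer A′
  through M0, T′ is an honest endgame.

No vacuum, tameness or maximality is used; everything is sorry-free over the landed vocabulary
(`PhotonSphereChannelsDarkFutureDefs.lean`, p151595).

References: M. Dafermos, J. Luk, arXiv:1710.01722, Conjecture 1 [DafermosLuk2017]; S. W. Hawking, G. F. R. Ellis,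
*The large scale structure of space-time*, CUP 1973, §9.2 [HawkingEllis1973CUP]; B. O'Neill, *Semi-Riemannian geometry*,
Academic Press 1983, Ch. 14, Lemma 14.42 [ONeillSemiRiemannian1983].
-/

noncomputable section

-- the operator-norm instance on `E4 →L[ℝ] E4 →L[ℝ] ℝ` needs one more level of pending
-- instance problems than the default (as in `PhotonSphereChannelsKerrDevDefs.lean`)
set_option maxSynthPendingDepth 3
-- every `Summit.FinalStateConjecture.FinalStateConjecture.…` name repeats the summit = sub-problem segment (D-0017 layout)
set_option linter.dupNamespace false

open Set Filter Function TopologicalSpace Manifold Bundle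
open scoped Topology Manifold ContDiff ENNReal NNReal

namespace Summit.FinalStateConjecture.FinalStateConjecture.Theorems.DarkFuture

open Literature.Geometry.Lorentzian
open Summit.FinalStateConjecture.FinalStateConjecture.Theorems.TameHull

section Development

variable {X : Type} [TopologicalSpace X] [ChartedSpace E3 X] [IsManifold (𝓡 3) ∞ X]
  [ConnectedSpace X] {D : InitialDataSet (𝓡 3) X}

/-! ### §1 The empty fibre = no future-complete normalised null ray from `Σ` -/

/-- **T′'s guard holds iff ONE future-complete normalised null ray from `Σ` exists**:
`(outerRegion 𝒟).Nonempty ↔ ∃ p γ dom, IsNormalisedNullRayFrom … p γ dom ∧ ¬ BddAbove dom` (⇒: an outer point sees the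
future branch of a complete ray by definition; ⇐: glue M0, a data point `ι x ≪ γ t`, `t > 0`, is outer).
[cite: HawkingEllis1973CUP, §9.2 (p. 312)] -/
theorem outerRegion_nonempty_iff_exists_completeRay (𝒟 : VacuumCauchyDevelopment D) [𝒟.metric.HasLeviCivita] :
    (outerRegion 𝒟).Nonempty ↔ ∃ (p : X) (γ : ℝ → 𝒟.carrier) (dom : Set ℝ),
      𝒟.metric.IsNormalisedNullRayFrom 𝒟.timeOrientation 𝒟.embed 𝒟.normal p γ dom ∧ ¬ BddAbove dom := by
  constructor
  · rintro ⟨-, -, p, γ, dom, hγ, hdom, -⟩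
    exact ⟨p, γ, dom, hγ, hdom⟩
  · rintro ⟨p, γ, dom, hγ, hdom⟩
    obtain ⟨x, hx⟩ := exists_embed_mem_outerRegion_of_completeRay 𝒟 hγ hdom
    exact ⟨𝒟.embed x, hx⟩

/-- **The empty-outer-region fibre is exactly the class of developments all of whose normalised null rays from `Σ`
are future incomplete** (bounded affine domain). [cite: HawkingEllis1973CUP, §9.2 (p. 312)] -/
theorem outerRegion_eq_empty_iff_forall_bddAbove (𝒟 : VacuumCauchyDevelopment D) [𝒟.metric.HasLeviCivita] :
    outerRegion 𝒟 = ∅ ↔ ∀ (p : X) (γ : ℝ → 𝒟.carrier) (dom : Set ℝ),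
      𝒟.metric.IsNormalisedNullRayFrom 𝒟.timeOrientation 𝒟.embed 𝒟.normal p γ dom → BddAbove dom := by
  rw [← not_nonempty_iff_eq_empty, outerRegion_nonempty_iff_exists_completeRay]
  simp only [not_exists, not_and, not_not]

/-- On the empty fibre every normalised null ray from `Σ` is future incomplete. [cite: HawkingEllis1973CUP, §9.2 (p. 312)] -/
theorem bddAbove_of_outerRegion_eq_empty {𝒟 : VacuumCauchyDevelopment D} [𝒟.metric.HasLeviCivita]
    (h : outerRegion 𝒟 = ∅) {p : X} {γ : ℝ → 𝒟.carrier} {dom : Set ℝ}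
    (hγ : 𝒟.metric.IsNormalisedNullRayFrom 𝒟.timeOrientation 𝒟.embed 𝒟.normal p γ dom) : BddAbove dom :=
  (outerRegion_eq_empty_iff_forall_bddAbove 𝒟).1 h p γ dom hγ

/-! ### §2 On the empty fibre the hypothesis block (a)–(d) of T′ is vacuous -/

/-- No future-escaping sequence on the empty-outer-region fibre (`q 0 ∈ ∅`). [folklore] -/
theorem not_isFutureEscaping_of_outerRegion_eq_empty {𝒟 : VacuumCauchyDevelopment D} [𝒟.metric.HasLeviCivita]
    (h : outerRegion 𝒟 = ∅) (q : ℕ → 𝒟.carrier) : ¬ IsFutureEscaping 𝒟 q := by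
  rintro ⟨hq, -⟩
  simpa [h] using hq 0

/-- No horizon generator path on the empty-outer-region fibre (`γ 0 ∈ closure ∅`). [folklore] -/
theorem not_isHorizonPath_of_outerRegion_eq_empty {𝒟 : VacuumCauchyDevelopment D} [𝒟.metric.HasLeviCivita]
    (h : outerRegion 𝒟 = ∅) (γ : ℝ → 𝒟.carrier) : ¬ IsHorizonPath 𝒟 γ := by
  rintro ⟨-, -, hcl, -⟩
  simpa [h] using hcl 0

/-- No silent outer hull element on the empty-outer-region fibre (its base sequence would be future-escaping). [folklore] -/
theorem not_isSilentHullElement_of_outerRegion_eq_empty {𝒟 : VacuumCauchyDevelopment D} [𝒟.metric.HasLeviCivita]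
    (h : outerRegion 𝒟 = ∅) (Λ : ℕ → ℝ≥0) (r₀ : ℝ) (q : ℕ → 𝒟.carrier) (𝓢 : Spacetime.{0} 4) (E : EndDatum 𝓢)
    (p : 𝓢.carrier) : ¬ IsSilentHullElement 𝒟 Λ r₀ q 𝓢 E p :=
  fun hZ ↦ not_isFutureEscaping_of_outerRegion_eq_empty h q hZ.1

/-- No horizon paths, hence (b) `GeneratorHullExists` holds vacuously on the empty fibre, in every class. [folklore] -/
theorem generatorHullExists_of_outerRegion_eq_empty {𝒟 : VacuumCauchyDevelopment D} [𝒟.metric.HasLeviCivita]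
    (h : outerRegion 𝒟 = ∅) (Λ : ℕ → ℝ≥0) (r₀ : ℝ) : GeneratorHullExists 𝒟 Λ r₀ :=
  fun γ hγ ↦ absurd hγ (not_isHorizonPath_of_outerRegion_eq_empty h γ)

/-- No future-escaping sequences, hence (a) `OuterHullExists` holds vacuously on the empty fibre, in every class.
[folklore] -/
theorem outerHullExists_of_outerRegion_eq_empty {𝒟 : VacuumCauchyDevelopment D} [𝒟.metric.HasLeviCivita]
    (h : outerRegion 𝒟 = ∅) (Λ : ℕ → ℝ≥0) (r₀ : ℝ) : OuterHullExists 𝒟 Λ r₀ :=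
  fun q hq ↦ absurd hq (not_isFutureEscaping_of_outerRegion_eq_empty h q)

end Development

/-- **Registered sub-goal `hypotheses_of_outerRegion_eq_empty` of stub T′ `stub_tameEndgame`** (line `dark-future-exactness`,
crux stmt-FinalStateConjecture-17430; the REASON for T′'s Reshape-1 guard `(outerRegion 𝒟).Nonempty`): on the fibre
`outerRegion 𝒟 = ∅` the whole hypothesis block of T′ — `0 < r₀ ∧ (a) OuterHullExists ∧ (b) GeneratorHullExists ∧
(c) every silent outer hull element is Minkowski or has a sub-extremal Kerr d.o.c. ∧ (d) parameter constancy along horizon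
generator paths`, verbatim — holds for EVERY class `(Λ, r₀)` with `r₀ > 0`, vacuously ((a), (c): no future-escaping
sequence; (b), (d): no horizon path). So an unguarded T would contain Φ♭ on this fibre; by
`outerRegion_eq_empty_iff_forall_bddAbove` the fibre is "no future-complete normalised null ray from `Σ`", excluded under
`DevHyp` only by the producer A′ (glue M0). [cite: DafermosLuk2017, Conjecture 1] -/
theorem hypotheses_of_outerRegion_eq_empty : ∀ {X : Type} [TopologicalSpace X] [ChartedSpace E3 X] [IsManifold (𝓡 3) ∞ X] [T2Space X] [SecondCountableTopology X] [ConnectedSpace X] {D : InitialDataSet (𝓡 3) X} (𝒟 : VacuumCauchyDevelopment D) [𝒟.metric.HasLeviCivita], outerRegion 𝒟 = ∅ → ∀ (Λ : ℕ → ℝ≥0) (r₀ : ℝ), 0 < r₀ → 0 < r₀ ∧ OuterHullExists 𝒟 Λ r₀ ∧ GeneratorHullExists 𝒟 Λ r₀ ∧ (∀ (q : ℕ → 𝒟.carrier) (𝓢 : Spacetime.{0} 4) (E : EndDatum 𝓢) (p : 𝓢.carrier), IsSilentHullElement 𝒟 Λ r₀ q 𝓢 E p → IsMinkowski 𝓢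 ∨ ∃ M a : ℝ, 0 < M ∧ |a| < M ∧ IsKerrDoc 𝓢 E.doc M a) ∧ (∀ γ : ℝ → 𝒟.carrier, IsHorizonPath 𝒟 γ → ∃ M a : ℝ, 0 < M ∧ |a| < M ∧ ∀ (𝓢 : Spacetime.{0} 4) (E : EndDatum 𝓢) (p : 𝓢.carrier), IsHorizonHullElement 𝒟 Λ r₀ γ 𝓢 E p → IsKerrDoc 𝓢 E.doc M a) := by
  intro X _ _ _ _ _ _ D 𝒟 _ h Λ r₀ hr₀
  exact ⟨hr₀, outerHullExists_of_outerRegion_eq_empty h Λ r₀, generatorHullExists_of_outerRegion_eq_empty h Λ r₀,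
    fun q _ _ _ hZ ↦ absurd hZ.1 (not_isFutureEscaping_of_outerRegion_eq_empty h q),
    fun γ hγ ↦ absurd hγ (not_isHorizonPath_of_outerRegion_eq_empty h γ)⟩

end Summit.FinalStateConjecture.FinalStateConjecture.Theorems.DarkFuture

end
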